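import Mathlib.Tactic.Abel
import Mathlib.Tactic.LinearCombination
import Mathlib.Algebra.BigOperators.Ring.Finset
import Literature.Computability.MetaComplexity.CosetFourier
import Literature.Computability.MetaComplexity.SmolenskyProperty
import HarnessLib

/-!
# Degree silence: a sparse sum of wide characters that agrees with a low-degree function on a
# parity coset vanishes there

SETTING.  As in `CosetFourier.lean` / `HoloCosetCover.lean`: a field `F` of characteristic `2`,
`ω ∈ F` a primitive cube root of unity, characters `Q_w(u) = ω^{⟨w,u⟩}` of `𝔽₃^z` restricted to the
cube `{0,1}^z`, holomorphic sums `R = Σ_g a_g Q_{w_g}` (`HoloCoset.holoSum`), the parity cosets `H_ε`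
(`ParityModTestDensity.parityCoset`), supports `wsupp`, and the degree filtration
`Smolensky.lowDeg F z d` (multilinear polynomials of degree `≤ d` on the cube, `SmolenskyProperty.lean`).

THEOREM (`degreeSilence`, the cell qa-qnc0's typed target `AffBells35.DegreeSilence`, ROUND-34
§12.6(e), verbatim): if `R` agrees on `H_ε` with some `L ∈ lowDeg F z d`, every live exponent vector
is `(2d + K)`-wide and `2m(K+1) < 2^K`, `z ≥ 1`, then `R ≡ 0` on `H_ε`.  (`d = 0` is
`CosetFourier.sparseKappa`.)

PROOF (pair operators, as proposed by the cell; organised here in FIXED dimension with a frozen set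
`A` of coordinates pinned to `0`, so that no re-indexing enters the induction).  `silence_frozen d`:
for every `A`, if `R` agrees with some `L ∈ lowDeg d` on `H_ε ∩ {u|_A = 0}` and the live exponent
vectors have `≥ 2d + K` non-zero coordinates outside `A`, then `R ≡ 0` there.  Step `d + 1 → d`: for a
pair `i ≠ j ∉ A` the differences `u ↦ R(u^{ij→11}) − R(u^{ij→00})` and `u ↦ R(u^{ij→10}) − R(u^{ij→01})`
on `{u|_{A∪{i,j}} = 0}` are again holomorphic sums with the SAME exponent vectors (coefficients
rescaled by `ω^{w_i+w_j} − 1`, resp. `ω^{w_i} − ω^{w_j}`), agree on the appropriate parity coset with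
`L(u^{11}) − L(u^{00})`, resp. `L(u^{10}) − L(u^{01})`, which lie in `lowDeg d`
(`sub_set2_mem_lowDeg`); the induction hypothesis makes them vanish, i.e. `R` is invariant under every
double flip on `H_ε ∩ {u|_A = 0}`; double flips act transitively there (`eq_of_toggle2_invariant`), so
`R` is constant, and `sparseKappa` — transported once to the sub-cube (`sparseKappa_frozen`) — makes
the constant `0`.

Printed relatives: the uncertainty principle of Barrington–Straubing–Thérien
[BarringtonStraubingTherien1990, §6] and Smolensky's degree method; this statement and proof are not
located in print and are SUPPLIED HERE (consumer: cell qa-qnc0).  No named facts.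
-/

namespace Literature.Computability.MetaComplexity

open Finset

open Literature.Computability.MetaComplexity.ParityModTestDensity
open Literature.Computability.MetaComplexity.HoloCoset
open Literature.Computability.MetaComplexity.CosetFourier
open Literature.Computability.MetaComplexity.Smolensky

namespace CosetDegreeSilence

variable {F : Type*} [Field F] {z m : ℕ}

/-! ### 1. Two-coordinate surgery on cube points -/

section Surgery

/-- Set the coordinates `i`, `j` of `u` to `x`, `y`. [folklore] -/
private def set2 (u : Fin z → Bool) (i j : Fin z) (x y : Bool) : Fin z → Bool :=
  Function.update (Function.update u i x) j y

variable {i j : Fin z}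

/-- [folklore] -/
private theorem set2_apply_left (u : Fin z → Bool) (hij : i ≠ j) (x y : Bool) :
    set2 u i j x y i = x := by
  simp [set2, Function.update_of_ne hij]

/-- [folklore] -/
private theorem set2_apply_right (u : Fin z → Bool) (x y : Bool) : set2 u i j x y j = y := by
  simp [set2]

/-- [folklore] -/
private theorem set2_apply_ne (u : Fin z → Bool) (x y : Bool) {k : Fin z} (hki : k ≠ i)
    (hkj : k ≠ j) : set2 u i j x y k = u k := by
  simp [set2, Function.update_of_ne hki, Function.update_of_ne hkj]

/-- [folklore] -/
private theorem set2_eq_self (u : Fin z → Bool) (hij : i ≠ j) {x y : Bool} (hx : u i = x)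
    (hy : u j = y) : set2 u i j x y = u := by
  funext k
  by_cases hkj : k = j
  · subst hkj; rw [set2_apply_right, hy]
  by_cases hki : k = i
  · subst hki; rw [set2_apply_left u hij, hx]
  rw [set2_apply_ne u x y hki hkj]

/-- [folklore] -/
private theorem set2_set2 (u : Fin z → Bool) (hij : i ≠ j) (x y x' y' : Bool) :
    set2 (set2 u i j x y) i j x' y' = set2 u i j x' y' := by
  funext k
  by_cases hkj : k = j
  · subst hkj; rw [set2_apply_right, set2_apply_right]
  by_cases hki : k = i
  · subst hki; rw [set2_apply_left _ hij, set2_apply_left _ hij]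
  rw [set2_apply_ne _ _ _ hki hkj, set2_apply_ne _ _ _ hki hkj, set2_apply_ne _ _ _ hki hkj]

/-- [folklore] -/
private theorem sum_eq_add_add_sum {M : Type*} [AddCommMonoid M] (g : Fin z → M) (hij : i ≠ j) :
    ∑ k, g k = g i + (g j + ∑ k ∈ (univ.erase i).erase j, g k) := by
  rw [Finset.add_sum_erase (univ.erase i) g (mem_erase.2 ⟨hij.symm, mem_univ j⟩),
    Finset.add_sum_erase univ g (mem_univ i)]

/-- Sums of coordinate functionals under two-coordinate surgery. [folklore] -/
private theorem sum_set2 {M : Type*} [AddCommMonoid M] (f : Fin z → Bool → M) (u : Fin z → Bool)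
    (hij : i ≠ j) (x y : Bool) :
    ∑ k, f k (set2 u i j x y k) + (f i (u i) + f j (u j))
      = ∑ k, f k (u k) + (f i x + f j y) := by
  rw [sum_eq_add_add_sum (fun k => f k (set2 u i j x y k)) hij,
    sum_eq_add_add_sum (fun k => f k (u k)) hij, set2_apply_left u hij, set2_apply_right]
  have : ∑ k ∈ (univ.erase i).erase j, f k (set2 u i j x y k)
      = ∑ k ∈ (univ.erase i).erase j, f k (u k) :=
    sum_congr rfl fun k hk => by
      rw [set2_apply_ne u x y (mem_erase.1 (mem_erase.1 hk).2).1 (mem_erase.1 hk).1]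
  rw [this]
  abel

/-- [folklore] -/
private theorem onesCard_eq_sum (u : Fin z → Bool) :
    onesCard u = ∑ k, if u k then 1 else 0 := by
  unfold onesCard; rw [card_filter]

/-- The number of ones under two-coordinate surgery. [folklore] -/
private theorem onesCard_set2 (u : Fin z → Bool) (hij : i ≠ j) (x y : Bool) :
    onesCard (set2 u i j x y) + ((if u i then 1 else 0) + (if u j then 1 else 0))
      = onesCard u + ((if x then 1 else 0) + (if y then 1 else 0)) := by
  rw [onesCard_eq_sum, onesCard_eq_sum]
  exact sum_set2 (fun _ c => if c then 1 else 0) u hij x y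

/-- [folklore] -/
private theorem mem_parityCoset' (ε : Bool) (u : Fin z → Bool) :
    u ∈ parityCoset z ε ↔ decide (Odd (onesCard u)) = ε := by
  unfold parityCoset onesCard; simp

/-- [folklore] -/
private theorem odd_iff_of_mod_eq {a b : ℕ} (h : a % 2 = b % 2) : (Odd a ↔ Odd b) := by
  rw [Nat.odd_iff, Nat.odd_iff, h]

/-- [folklore] -/
private theorem mod_two_eq_of_odd_iff {a b : ℕ} (h : Odd a ↔ Odd b) : a % 2 = b % 2 := by
  rw [Nat.odd_iff, Nat.odd_iff] at h
  rcases Nat.mod_two_eq_zero_or_one a with ha | ha <;>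
    rcases Nat.mod_two_eq_zero_or_one b with hb | hb <;> simp_all

/-- [folklore] -/
private theorem decide_odd_eq_iff (a : ℕ) (ε : Bool) : decide (Odd a) = ε ↔ a % 2 = ε.toNat := by
  cases ε <;> simp [Nat.odd_iff]

/-- Parity of a point obtained by surgery from a point with `u_i = u_j = 0`. [folklore] -/
private theorem mem_parityCoset_set2 (ε : Bool) (u : Fin z → Bool) (hij : i ≠ j) (hi : u i = false)
    (hj : u j = false) (x y : Bool) :
    set2 u i j x y ∈ parityCoset z ε ↔
      u ∈ parityCoset z (xor ε (xor x y)) := by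
  have h := onesCard_set2 u hij x y
  rw [hi, hj] at h
  rw [mem_parityCoset', mem_parityCoset', decide_odd_eq_iff, decide_odd_eq_iff]
  cases x <;> cases y <;> cases ε <;>
    simp only [Bool.false_eq_true, ↓reduceIte, add_zero, Bool.xor_false, Bool.xor_true,
      Bool.not_false, Bool.not_true, Bool.toNat_false, Bool.toNat_true] at h ⊢ <;> omega

end Surgery

/-! ### 2. Characters and holomorphic sums under surgery -/

section Characters

variable {ω : F} {i j : Fin z}

/-- [folklore] -/
private theorem omega_pow_mod (h3 : ω ^ 3 = 1) (n : ℕ) : ω ^ (n % 3) = ω ^ n := by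
  conv_rhs => rw [← Nat.mod_add_div n 3, pow_add, pow_mul, h3, one_pow, mul_one]

/-- [folklore] -/
private theorem omega_pow_val_add (h3 : ω ^ 3 = 1) (s t : ZMod 3) :
    ω ^ (s + t).val = ω ^ s.val * ω ^ t.val := by
  rw [ZMod.val_add, omega_pow_mod h3, pow_add]

/-- [folklore] -/
private theorem omega_pow_three' (hω : ω ^ 2 + ω + 1 = 0) : ω ^ 3 = 1 := by
  have : ω ^ 3 - 1 = (ω - 1) * (ω ^ 2 + ω + 1) := by ring
  rw [hω, mul_zero, sub_eq_zero] at this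
  exact this

/-- `Q_w` under surgery at two zero coordinates: `Q_w(u^{ij→xy}) = Q_w(u)·ω^{[x]w_i + [y]w_j}`. [folklore] -/
private theorem cubeChar_set2 (h3 : ω ^ 3 = 1) (w : Fin z → ZMod 3) (u : Fin z → Bool) (hij : i ≠ j)
    (hi : u i = false) (hj : u j = false) (x y : Bool) :
    cubeChar ω w (set2 u i j x y)
      = cubeChar ω w u * ω ^ ((if x then w i else 0) + (if y then w j else 0)).val := by
  unfold cubeChar
  have h := sum_set2 (fun k c => if c then w k else (0 : ZMod 3)) u hij x y
  rw [hi, hj] at h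
  simp only [Bool.false_eq_true, ↓reduceIte, add_zero] at h
  rw [h, omega_pow_val_add h3]

/-- A holomorphic sum under surgery is a holomorphic sum with the same exponent vectors and
rescaled coefficients. [folklore] -/
private theorem holoSum_set2 (h3 : ω ^ 3 = 1) (a : Fin m → F) (w : Fin m → Fin z → ZMod 3)
    (u : Fin z → Bool) (hij : i ≠ j) (hi : u i = false) (hj : u j = false) (x y : Bool) :
    holoSum ω a w (set2 u i j x y)
      = holoSum ω (fun g => a g * ω ^ ((if x then w g i else 0) + (if y then w g j else 0)).val) w u := by
  unfold holoSum
  exact sum_congr rfl fun g _ => by rw [cubeChar_set2 h3 (w g) u hij hi hj]; ring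

/-- [folklore] -/
private theorem holoSum_sub (ω : F) (a a' : Fin m → F) (w : Fin m → Fin z → ZMod 3) (u : Fin z → Bool) :
    holoSum ω a w u - holoSum ω a' w u = holoSum ω (fun g => a g - a' g) w u := by
  unfold holoSum
  rw [← sum_sub_distrib]
  exact sum_congr rfl fun g _ => by ring

end Characters

/-! ### 3. The degree filtration under surgery -/

section Degree

variable {i j : Fin z}

/-- [folklore] -/
private theorem forall_set2_iff (S : Finset (Fin z)) (u : Fin z → Bool) (hij : i ≠ j) (x y : Bool) :
    (∀ k ∈ S, set2 u i j x y k = true) ↔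
      ((i ∈ S → x = true) ∧ (j ∈ S → y = true) ∧ ∀ k ∈ S \ {i, j}, u k = true) := by
  constructor
  · intro h
    refine ⟨fun hi => ?_, fun hj => ?_, fun k hk => ?_⟩
    · rw [← set2_apply_left u hij x y]; exact h i hi
    · rw [← set2_apply_right (i := i) u x y]; exact h j hj
    · rw [mem_sdiff] at hk
      have hki : k ≠ i := fun e => hk.2 (by simp [e])
      have hkj : k ≠ j := fun e => hk.2 (by simp [e])
      rw [← set2_apply_ne u x y hki hkj]; exact h k hk.1
  · rintro ⟨hx, hy, hrest⟩ k hk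
    by_cases hkj : k = j
    · subst hkj; rw [set2_apply_right]; exact hy hk
    by_cases hki : k = i
    · subst hki; rw [set2_apply_left u hij]; exact hx hk
    rw [set2_apply_ne u x y hki hkj]
    exact hrest k (mem_sdiff.2 ⟨hk, by simp [hki, hkj]⟩)

/-- A monomial not involving `i`, `j` ignores surgery there. [folklore] -/
private theorem mono_set2_of_not_mem {S : Finset (Fin z)} (hi : i ∉ S) (hj : j ∉ S) (u : Fin z → Bool)
    (x y : Bool) : mono F S (set2 u i j x y) = mono F S u := by
  unfold mono
  refine prod_congr rfl fun k hk => ?_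
  rw [set2_apply_ne u x y (ne_of_mem_of_not_mem hk hi) (ne_of_mem_of_not_mem hk hj)]

/-- A monomial involving `i` or `j`, after surgery, is `0` or the monomial `x_{S ∖ {i,j}}`. [folklore] -/
private theorem mono_set2_eq {S : Finset (Fin z)} (hij : i ≠ j) (u : Fin z → Bool) (x y : Bool) :
    mono F S (set2 u i j x y)
      = if (i ∈ S → x = true) ∧ (j ∈ S → y = true) then mono F (S \ {i, j}) u else 0 := by
  classical
  rw [mono_apply, mono_apply]
  by_cases hc : (i ∈ S → x = true) ∧ (j ∈ S → y = true)
  · rw [if_pos hc]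
    by_cases hr : ∀ k ∈ S \ {i, j}, u k = true
    · rw [if_pos hr, if_pos ((forall_set2_iff S u hij x y).2 ⟨hc.1, hc.2, hr⟩)]
    · rw [if_neg hr, if_neg fun h => hr ((forall_set2_iff S u hij x y).1 h).2.2]
  · rw [if_neg hc, if_neg fun h => hc ⟨((forall_set2_iff S u hij x y).1 h).1,
      ((forall_set2_iff S u hij x y).1 h).2.1⟩]

/-- **Surgery differences lower the degree**: for `L ∈ lowDeg (d+1)` and `i ≠ j`,
`u ↦ L(u^{ij→xy}) − L(u^{ij→x'y'})` lies in `lowDeg d`.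
[cite: BarringtonStraubingTherien1990, §6; degree bookkeeping supplied here (qa-qnc0 ROUND-34 §12.6(e))] -/
theorem sub_set2_mem_lowDeg {d : ℕ} {L : CubeFn F z} (hL : L ∈ lowDeg F z (d + 1)) (hij : i ≠ j)
    (x y x' y' : Bool) :
    (fun u => L (Function.update (Function.update u i x) j y)
      - L (Function.update (Function.update u i x') j y')) ∈ lowDeg F z d := by
  classical
  change (fun u => L (set2 u i j x y) - L (set2 u i j x' y')) ∈ lowDeg F z d
  rw [lowDeg_eq_span] at hL
  induction hL using Submodule.span_induction with
  | mem f hf =>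
    obtain ⟨⟨S, hS⟩, rfl⟩ := hf
    by_cases hmem : i ∈ S ∨ j ∈ S
    · -- both terms are multiples of the monomial of S \ {i,j}, of degree ≤ d
      have hcard : (S \ {i, j}).card ≤ d := by
        have hss : S \ {i, j} ⊂ S := by
          refine (ssubset_iff_of_subset sdiff_subset).2 ?_
          rcases hmem with h | h
          · exact ⟨i, h, by simp⟩
          · exact ⟨j, h, by simp⟩
        have := card_lt_card hss
        omega
      have hm : mono F (S \ {i, j}) ∈ lowDeg F z d := mono_mem_lowDeg hcard
      have h1 : (fun u => mono F S (set2 u i j x y)) ∈ lowDeg F z d := by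
        by_cases hc : (i ∈ S → x = true) ∧ (j ∈ S → y = true)
        · have : (fun u => mono F S (set2 u i j x y)) = mono F (S \ {i, j}) := by
            funext u; rw [mono_set2_eq hij, if_pos hc]
          rw [this]; exact hm
        · have : (fun u => mono F S (set2 u i j x y)) = 0 := by
            funext u; rw [mono_set2_eq hij, if_neg hc]; rfl
          rw [this]; exact Submodule.zero_mem _
      have h2 : (fun u => mono F S (set2 u i j x' y')) ∈ lowDeg F z d := by
        by_cases hc : (i ∈ S → x' = true) ∧ (j ∈ S → y' = true)
        · have : (fun u => mono F S (set2 u i j x' y')) = mono F (S \ {i, j}) := by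
            funext u; rw [mono_set2_eq hij, if_pos hc]
          rw [this]; exact hm
        · have : (fun u => mono F S (set2 u i j x' y')) = 0 := by
            funext u; rw [mono_set2_eq hij, if_neg hc]; rfl
          rw [this]; exact Submodule.zero_mem _
      have := Submodule.sub_mem _ h1 h2
      exact this
    · push Not at hmem
      have : (fun u => mono F S (set2 u i j x y) - mono F S (set2 u i j x' y')) = 0 := by
        funext u
        rw [mono_set2_of_not_mem hmem.1 hmem.2, mono_set2_of_not_mem hmem.1 hmem.2, sub_self]
        rfl
      rw [this]; exact Submodule.zero_mem _
  | zero => simp only [Pi.zero_apply, sub_self]; exact Submodule.zero_mem _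
  | add f g _ _ hf hg =>
    have := Submodule.add_mem _ hf hg
    convert this using 1
    funext u; simp only [Pi.add_apply]; ring
  | smul c f _ hf =>
    have := Submodule.smul_mem _ c hf
    convert this using 1
    funext u; simp only [Pi.smul_apply, smul_eq_mul]; ring

/-- Degree `0` means constant. [folklore] -/
private theorem const_of_mem_lowDeg_zero {L : CubeFn F z} (hL : L ∈ lowDeg F z 0) (u v : Fin z → Bool) :
    L u = L v := by
  rw [lowDeg_eq_span] at hL
  induction hL using Submodule.span_induction with
  | mem f hf =>
    obtain ⟨⟨S, hS⟩, rfl⟩ := hf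
    have hS0 : S = ∅ := card_eq_zero.1 (Nat.le_zero.1 hS)
    subst hS0
    simp [mono_apply]
  | zero => rfl
  | add f g _ _ hf hg => simp only [Pi.add_apply, hf, hg]
  | smul c f _ hf => simp only [Pi.smul_apply, hf]

end Degree

/-! ### 4. `sparseKappa` on a sub-cube (the only re-indexing) -/

section Frozen

/-- The free coordinates (complement of the frozen set `A`). [folklore] -/
private def freeSet (A : Finset (Fin z)) : Finset (Fin z) := univ.filter fun i => i ∉ A

/-- [folklore] -/
private theorem mem_freeSet {A : Finset (Fin z)} {i : Fin z} : i ∈ freeSet A ↔ i ∉ A := by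
  unfold freeSet; simp

/-- An enumeration of the free coordinates. [folklore] -/
private def freeEquiv (A : Finset (Fin z)) : Fin (freeSet A).card ≃ {x // x ∈ freeSet A} :=
  ((freeSet A).orderIsoOfFin rfl).toEquiv

/-- Lift a point of the small cube (indexed by the free coordinates) to the big cube, `0` on `A`.
[folklore] -/
private def liftPt (A : Finset (Fin z)) (u' : Fin (freeSet A).card → Bool) : Fin z → Bool :=
  fun i => if h : i ∈ freeSet A then u' ((freeEquiv A).symm ⟨i, h⟩) else false

/-- [folklore] -/
private theorem liftPt_equiv (A : Finset (Fin z)) (u' : Fin (freeSet A).card → Bool)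
    (k : Fin (freeSet A).card) : liftPt A u' (freeEquiv A k) = u' k := by
  simp only [liftPt, (freeEquiv A k).2, ↓reduceDIte, Subtype.coe_eta, Equiv.symm_apply_apply]

/-- [folklore] -/
private theorem liftPt_of_mem (A : Finset (Fin z)) (u' : Fin (freeSet A).card → Bool) {i : Fin z}
    (hi : i ∈ A) : liftPt A u' i = false := by
  have : i ∉ freeSet A := fun h => (mem_freeSet.1 h) hi
  simp only [liftPt, this, ↓reduceDIte]

/-- Sums of functions vanishing on `A` are sums over the free coordinates. [folklore] -/
private theorem sum_reindex (A : Finset (Fin z)) {M : Type} [AddCommMonoid M] (f : Fin z → M)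
    (hf : ∀ i ∈ A, f i = 0) : ∑ i, f i = ∑ k, f (freeEquiv A k) := by
  have h1 : ∑ i, f i = ∑ i ∈ freeSet A, f i :=
    (sum_subset (subset_univ (freeSet A))
      (fun i _ hi => hf i (not_not.1 (mem_freeSet.not.1 hi)))).symm
  rw [h1]
  conv_lhs => rw [← Finset.sum_coe_sort]
  rw [← Equiv.sum_comp (freeEquiv A)]

variable [CharP F 2]

/-- `sparseKappa` with a frozen set `A` of coordinates pinned to `0`: widths are counted outside `A`,
constancy is required on `H_ε ∩ {u|_A = 0}`.
[cite: BarringtonStraubingTherien1990, §6 (Proposition: uncertainty); sub-cube transport supplied here] -/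
theorem sparseKappa_frozen {ω : F} (hω : ω ^ 2 + ω + 1 = 0) {K : ℕ} (A : Finset (Fin z))
    (hA : ∃ i, i ∉ A) (hmK : 2 * m * (K + 1) < 2 ^ K) (a : Fin m → F)
    (w : Fin m → Fin z → ZMod 3) (ε : Bool) (κ : F)
    (hsupp : ∀ g, a g ≠ 0 → K ≤ ((univ.filter fun i => i ∉ A).filter fun i => w g i ≠ 0).card)
    (hconst : ∀ u ∈ parityCoset z ε, (∀ i ∈ A, u i = false) → holoSum ω a w u = κ) :
    κ = 0 := by
  classical
  -- the transported exponent vectors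
  set w' : Fin m → Fin (freeSet A).card → ZMod 3 := fun g k => w g (freeEquiv A k) with hw'
  have hchar : ∀ g u', cubeChar ω (w g) (liftPt A u') = cubeChar ω (w' g) u' := by
    intro g u'
    unfold cubeChar
    congr 2
    rw [sum_reindex A (fun i => if liftPt A u' i then w g i else 0)
      (fun i hi => by rw [liftPt_of_mem A u' hi]; rfl)]
    exact sum_congr rfl fun k _ => by rw [liftPt_equiv]
  have hsum : ∀ u', holoSum ω a w (liftPt A u') = holoSum ω a w' u' := by
    intro u'; unfold holoSum; exact sum_congr rfl fun g _ => by rw [hchar]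
  have hones : ∀ u', onesCard (liftPt A u') = onesCard u' := by
    intro u'
    unfold onesCard
    rw [card_filter, card_filter, sum_reindex A (fun i => if liftPt A u' i = true then 1 else 0)
      (fun i hi => by rw [liftPt_of_mem A u' hi]; rfl)]
    exact sum_congr rfl fun k _ => by rw [liftPt_equiv]
  have hcoset : ∀ u', u' ∈ parityCoset (freeSet A).card ε → liftPt A u' ∈ parityCoset z ε := by
    intro u' hu'
    rw [mem_parityCoset'] at hu' ⊢
    rwa [hones]
  have hwsupp : ∀ g, (wsupp (w' g)).card
      = ((univ.filter fun i => i ∉ A).filter fun i => w g i ≠ 0).card := by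
    intro g
    change _ = ((freeSet A).filter fun i => w g i ≠ 0).card
    unfold wsupp
    rw [card_filter, card_filter]
    conv_rhs => rw [← Finset.sum_coe_sort]
    rw [← Equiv.sum_comp (freeEquiv A)]
  have hzpos : 0 < (freeSet A).card := by
    obtain ⟨i, hi⟩ := hA
    exact card_pos.2 ⟨i, mem_freeSet.2 hi⟩
  exact sparseKappa F ω hω (freeSet A).card m K a w' ε κ hzpos hmK
    (fun g hg => by rw [hwsupp]; exact hsupp g hg)
    (fun u' hu' => by rw [← hsum]; exact hconst _ (hcoset u' hu') (fun i hi => liftPt_of_mem A u' hi))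

/-- Constancy on `H_ε ∩ {u|_A = 0}` plus `K`-width outside `A` forces vanishing there. [folklore] -/
private theorem zero_of_const {ω : F} (hω : ω ^ 2 + ω + 1 = 0) {K : ℕ} (A : Finset (Fin z))
    (hmK : 2 * m * (K + 1) < 2 ^ K) (a : Fin m → F) (w : Fin m → Fin z → ZMod 3) (ε : Bool) (κ : F)
    (hsupp : ∀ g, a g ≠ 0 → K ≤ ((univ.filter fun i => i ∉ A).filter fun i => w g i ≠ 0).card)
    (hconst : ∀ u ∈ parityCoset z ε, (∀ i ∈ A, u i = false) → holoSum ω a w u = κ) :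
    ∀ u ∈ parityCoset z ε, (∀ i ∈ A, u i = false) → holoSum ω a w u = 0 := by
  classical
  intro u hu huA
  by_cases hlive : ∃ g, a g ≠ 0
  · obtain ⟨g, hg⟩ := hlive
    -- a live term is K-wide outside A with K ≥ 1, so A ≠ univ
    have hm : 1 ≤ m := Nat.one_le_iff_ne_zero.2 fun h => by subst h; exact g.elim0
    have hK : 1 ≤ K := by
      by_contra h0
      have : K = 0 := by omega
      subst this
      simp at hmK; omega
    have hA : ∃ i, i ∉ A := by
      have hc := hsupp g hg
      obtain ⟨i, hi⟩ := card_pos.1 (by omega :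
        0 < ((univ.filter fun i => i ∉ A).filter fun i => w g i ≠ 0).card)
      exact ⟨i, (mem_filter.1 (mem_filter.1 hi).1).2⟩
    rw [hconst u hu huA]
    exact sparseKappa_frozen hω A hA hmK a w ε κ hsupp hconst
  · push Not at hlive
    unfold holoSum
    exact sum_eq_zero fun g _ => by rw [hlive g, zero_mul]

end Frozen

/-! ### 5. Double flips act transitively on `H_ε ∩ {u|_A = 0}` -/

section Flips

variable {i j : Fin z}

/-- Two points of the same parity coset that differ somewhere differ in two coordinates. [folklore] -/
private theorem exists_two_diff {ε : Bool} {u v : Fin z → Bool} (hu : u ∈ parityCoset z ε)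
    (hv : v ∈ parityCoset z ε) (huv : u ≠ v) :
    ∃ i j : Fin z, i ≠ j ∧ u i ≠ v i ∧ u j ≠ v j := by
  classical
  obtain ⟨i, hi⟩ : ∃ i, u i ≠ v i := by
    by_contra h; push Not at h; exact huv (funext h)
  by_contra hno
  push Not at hno
  -- then v is u with the single coordinate i toggled: parities differ
  have hv' : v = Function.update u i (!u i) := by
    funext k
    by_cases hk : k = i
    · subst hk
      rw [Function.update_self]
      revert hi; cases u k <;> cases v k <;> simp
    · rw [Function.update_of_ne hk]
      exact (hno i k (Ne.symm hk) hi).symm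
  have hone : onesCard v + (if u i then 1 else 0) = onesCard u + (if (!u i) then 1 else 0) := by
    rw [hv', onesCard_eq_sum, onesCard_eq_sum, ← Finset.add_sum_erase univ _ (mem_univ i),
      ← Finset.add_sum_erase univ (fun k => if u k = true then 1 else 0) (mem_univ i),
      Function.update_self]
    have : ∑ x ∈ univ.erase i, (if Function.update u i (!u i) x = true then 1 else 0)
        = ∑ x ∈ univ.erase i, (if u x = true then 1 else 0) :=
      sum_congr rfl fun k hk => by rw [Function.update_of_ne (mem_erase.1 hk).1]
    rw [this]; omega
  rw [mem_parityCoset'] at hu hv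
  rw [← hu] at hv
  have hpar : onesCard v % 2 = onesCard u % 2 := mod_two_eq_of_odd_iff (decide_eq_decide.1 hv)
  revert hone
  cases u i <;> simp <;> omega

omit [Field F] in
/-- If `R` is invariant under every double flip at pairs outside `A` on `H_ε ∩ {u|_A = 0}`, then `R` is
constant there.
[cite: BarringtonStraubingTherien1990, §6; transitivity bookkeeping supplied here (qa-qnc0 ROUND-34 §12.6(e))] -/
theorem eq_of_toggle2_invariant (R : (Fin z → Bool) → F) (A : Finset (Fin z)) (ε : Bool)
    (hinv : ∀ u ∈ parityCoset z ε, (∀ k ∈ A, u k = false) → ∀ i j : Fin z, i ≠ j → i ∉ A → j ∉ A →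
      R (Function.update (Function.update u i (!u i)) j (!u j)) = R u)
    {u v : Fin z → Bool} (hu : u ∈ parityCoset z ε) (huA : ∀ k ∈ A, u k = false)
    (hv : v ∈ parityCoset z ε) (hvA : ∀ k ∈ A, v k = false) : R u = R v := by
  classical
  -- strong induction on the number of differing coordinates
  suffices key : ∀ n (u : Fin z → Bool), (univ.filter fun k => u k ≠ v k).card = n →
      u ∈ parityCoset z ε → (∀ k ∈ A, u k = false) → R u = R v from key _ u rfl hu huA
  intro n
  induction n using Nat.strong_induction_on with
  | _ n ih =>
    intro u hn hu huA
    by_cases huv : u = v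
    · rw [huv]
    obtain ⟨i, j, hij, hi, hj⟩ := exists_two_diff hu hv huv
    have hiA : i ∉ A := fun h => hi (by rw [huA i h, hvA i h])
    have hjA : j ∉ A := fun h => hj (by rw [huA j h, hvA j h])
    set u₁ := set2 u i j (!u i) (!u j) with hu₁
    have hR : R u₁ = R u := hinv u hu huA i j hij hiA hjA
    -- u₁ agrees with v at i and j
    have h1i : u₁ i = v i := by
      rw [hu₁, set2_apply_left u hij]; revert hi; cases u i <;> cases v i <;> simp
    have h1j : u₁ j = v j := by
      rw [hu₁, set2_apply_right]; revert hj; cases u j <;> cases v j <;> simp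
    have hsub : (univ.filter fun k => u₁ k ≠ v k)
        ⊆ ((univ.filter fun k => u k ≠ v k).erase i).erase j := by
      intro k hk
      have hk' := (mem_filter.1 hk).2
      have hki : k ≠ i := fun e => by subst e; exact hk' h1i
      have hkj : k ≠ j := fun e => by subst e; exact hk' h1j
      rw [hu₁, set2_apply_ne u _ _ hki hkj] at hk'
      exact mem_erase.2 ⟨hkj, mem_erase.2 ⟨hki, mem_filter.2 ⟨mem_univ _, hk'⟩⟩⟩
    have hmi : i ∈ univ.filter fun k => u k ≠ v k := mem_filter.2 ⟨mem_univ _, hi⟩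
    have hmj : j ∈ (univ.filter fun k => u k ≠ v k).erase i :=
      mem_erase.2 ⟨hij.symm, mem_filter.2 ⟨mem_univ _, hj⟩⟩
    have hlt : (univ.filter fun k => u₁ k ≠ v k).card < n := by
      have := card_le_card hsub
      rw [card_erase_of_mem hmj, card_erase_of_mem hmi, hn] at this
      have hnpos : 0 < n := by rw [← hn]; exact card_pos.2 ⟨i, hmi⟩
      omega
    -- u₁ is again in H_ε ∩ {u|_A = 0}
    have hu₁c : u₁ ∈ parityCoset z ε := by
      have h := onesCard_set2 u hij (!u i) (!u j)
      rw [mem_parityCoset'] at hu ⊢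
      rw [← hu]
      rw [decide_eq_decide]
      apply odd_iff_of_mod_eq
      revert h; rw [← hu₁]
      cases u i <;> cases u j <;> simp <;> omega
    have hu₁A : ∀ k ∈ A, u₁ k = false := by
      intro k hk
      rw [hu₁, set2_apply_ne u _ _ (ne_of_mem_of_not_mem hk hiA) (ne_of_mem_of_not_mem hk hjA)]
      exact huA k hk
    rw [← hR]
    exact ih _ hlt u₁ rfl hu₁c hu₁A

end Flips

/-! ### 6. The induction and the theorem -/

section Main

variable [CharP F 2]

/-- `silence_frozen d`: the frozen-set form of degree silence, by induction on the degree.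
[cite: BarringtonStraubingTherien1990, §6; supplied here (qa-qnc0 ROUND-34 §12.6(e))] -/
theorem silence_frozen {ω : F} (hω : ω ^ 2 + ω + 1 = 0) {K : ℕ} (hmK : 2 * m * (K + 1) < 2 ^ K)
    (w : Fin m → Fin z → ZMod 3) :
    ∀ (d : ℕ) (A : Finset (Fin z)) (ε : Bool) (a : Fin m → F) (L : CubeFn F z),
      (∀ g, a g ≠ 0 → 2 * d + K ≤ ((univ.filter fun i => i ∉ A).filter fun i => w g i ≠ 0).card) →
      L ∈ lowDeg F z d →
      (∀ u ∈ parityCoset z ε, (∀ i ∈ A, u i = false) → holoSum ω a w u = L u) →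
      ∀ u ∈ parityCoset z ε, (∀ i ∈ A, u i = false) → holoSum ω a w u = 0 := by
  classical
  have h3 : ω ^ 3 = 1 := omega_pow_three' hω
  intro d
  induction d with
  | zero =>
    intro A ε a L hsupp hL hRL
    -- L is constant; sparseKappa on the sub-cube
    refine zero_of_const hω A hmK a w ε (L fun _ => false) (fun g hg => by simpa using hsupp g hg)
      fun u hu huA => ?_
    rw [hRL u hu huA]; exact const_of_mem_lowDeg_zero hL _ _
  | succ d ih =>
    intro A ε a L hsupp hL hRL
    -- widths outside A ∪ {i, j}
    have hsupp2 : ∀ (i j : Fin z) (a' : Fin m → F), (∀ g, a' g ≠ 0 → a g ≠ 0) →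
        ∀ g, a' g ≠ 0 → 2 * d + K ≤
          ((univ.filter fun k => k ∉ A ∪ {i, j}).filter fun k => w g k ≠ 0).card := by
      intro i j a' ha' g hg
      have h := hsupp g (ha' g hg)
      have hsub : ((univ.filter fun k => k ∉ A).filter fun k => w g k ≠ 0)
          ⊆ ((univ.filter fun k => k ∉ A ∪ {i, j}).filter fun k => w g k ≠ 0) ∪ {i, j} := by
        intro k hk
        rw [mem_filter, mem_filter] at hk
        by_cases hk2 : k ∈ ({i, j} : Finset (Fin z))
        · exact mem_union_right _ hk2
        · refine mem_union_left _ (mem_filter.2 ⟨mem_filter.2 ⟨mem_univ _, ?_⟩, hk.2⟩)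
          rw [mem_union, not_or]; exact ⟨hk.1.2, hk2⟩
      have := (card_le_card hsub).trans (card_union_le _ _)
      have h2 : ({i, j} : Finset (Fin z)).card ≤ 2 := (card_insert_le _ _).trans (by simp)
      omega
    -- P-invariance and Q-invariance from the induction hypothesis
    have hP : ∀ (i j : Fin z), i ≠ j → i ∉ A → j ∉ A → ∀ b ∈ parityCoset z ε,
        (∀ k ∈ A ∪ {i, j}, b k = false) → holoSum ω a w (set2 b i j true true) = holoSum ω a w b := by
      intro i j hij hiA hjA b hb hbA
      have hbi : b i = false := hbA i (by simp)
      have hbj : b j = false := hbA j (by simp)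
      -- the P-difference as a holomorphic sum
      set aP : Fin m → F := fun g => a g * ω ^ ((if true then w g i else 0) + (if true then w g j else 0)).val - a g
        with haP
      have hlive : ∀ g, aP g ≠ 0 → a g ≠ 0 := by
        intro g hg h0; apply hg; rw [haP]; simp only [h0, zero_mul, sub_zero]
      have hLP := sub_set2_mem_lowDeg hL hij true true false false
      have hagree : ∀ u ∈ parityCoset z ε, (∀ k ∈ A ∪ {i, j}, u k = false) →
          holoSum ω aP w u = (fun u => L (Function.update (Function.update u i true) j true)
            - L (Function.update (Function.update u i false) j false)) u := by
        intro u hu huA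
        have hui : u i = false := huA i (by simp)
        have huj : u j = false := huA j (by simp)
        have huA' : ∀ k ∈ A, u k = false := fun k hk => huA k (mem_union_left _ hk)
        rw [haP, ← holoSum_sub, ← holoSum_set2 h3 a w u hij hui huj]
        change holoSum ω a w (set2 u i j true true) - holoSum ω a w u
          = L (set2 u i j true true) - L (set2 u i j false false)
        rw [set2_eq_self u hij hui huj, hRL u hu huA', hRL (set2 u i j true true) _ fun k hk => ?_]
        · rw [mem_parityCoset_set2 ε u hij hui huj]; simpa using hu
        · rw [set2_apply_ne u _ _ (ne_of_mem_of_not_mem hk hiA) (ne_of_mem_of_not_mem hk hjA)]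
          exact huA' k hk
      have h0 := ih (A ∪ {i, j}) ε aP _ (hsupp2 i j aP hlive) hLP hagree b hb hbA
      rw [haP, ← holoSum_sub, ← holoSum_set2 h3 a w b hij hbi hbj, sub_eq_zero] at h0
      exact h0
    have hQ : ∀ (i j : Fin z), i ≠ j → i ∉ A → j ∉ A → ∀ b ∈ parityCoset z (!ε),
        (∀ k ∈ A ∪ {i, j}, b k = false) →
          holoSum ω a w (set2 b i j true false) = holoSum ω a w (set2 b i j false true) := by
      intro i j hij hiA hjA b hb hbA
      have hbi : b i = false := hbA i (by simp)
      have hbj : b j = false := hbA j (by simp)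
      set aQ : Fin m → F := fun g =>
        a g * ω ^ ((if true then w g i else 0) + (if false then w g j else 0)).val
          - a g * ω ^ ((if false then w g i else 0) + (if true then w g j else 0)).val with haQ
      have hlive : ∀ g, aQ g ≠ 0 → a g ≠ 0 := by
        intro g hg h0; apply hg; rw [haQ]; simp only [h0, zero_mul, sub_zero]
      have hLQ := sub_set2_mem_lowDeg hL hij true false false true
      have hagree : ∀ u ∈ parityCoset z (!ε), (∀ k ∈ A ∪ {i, j}, u k = false) →
          holoSum ω aQ w u = (fun u => L (Function.update (Function.update u i true) j false)
            - L (Function.update (Function.update u i false) j true)) u := by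
        intro u hu huA
        have hui : u i = false := huA i (by simp)
        have huj : u j = false := huA j (by simp)
        have huA' : ∀ k ∈ A, u k = false := fun k hk => huA k (mem_union_left _ hk)
        rw [haQ, ← holoSum_sub, ← holoSum_set2 h3 a w u hij hui huj,
          ← holoSum_set2 h3 a w u hij hui huj]
        change holoSum ω a w (set2 u i j true false) - holoSum ω a w (set2 u i j false true)
          = L (set2 u i j true false) - L (set2 u i j false true)
        have hmemA : ∀ x y, ∀ k ∈ A, set2 u i j x y k = false := fun x y k hk => by
          rw [set2_apply_ne u _ _ (ne_of_mem_of_not_mem hk hiA) (ne_of_mem_of_not_mem hk hjA)]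
          exact huA' k hk
        rw [hRL (set2 u i j true false) _ (hmemA _ _), hRL (set2 u i j false true) _ (hmemA _ _)]
        · rw [mem_parityCoset_set2 ε u hij hui huj]; simpa using hu
        · rw [mem_parityCoset_set2 ε u hij hui huj]; simpa using hu
      have h0 := ih (A ∪ {i, j}) (!ε) aQ _ (hsupp2 i j aQ hlive) hLQ hagree b hb hbA
      rw [haQ, ← holoSum_sub, ← holoSum_set2 h3 a w b hij hbi hbj,
        ← holoSum_set2 h3 a w b hij hbi hbj, sub_eq_zero] at h0
      exact h0
    -- invariance of R under all double flips on H_ε ∩ {u|_A = 0}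
    have hinv : ∀ u ∈ parityCoset z ε, (∀ k ∈ A, u k = false) → ∀ i j : Fin z, i ≠ j → i ∉ A →
        j ∉ A → holoSum ω a w (Function.update (Function.update u i (!u i)) j (!u j))
          = holoSum ω a w u := by
      intro u hu huA i j hij hiA hjA
      change holoSum ω a w (set2 u i j (!u i) (!u j)) = holoSum ω a w u
      -- base point b := u^{ij→00}
      set b := set2 u i j false false with hb
      have hbi : b i = false := by rw [hb, set2_apply_left u hij]
      have hbj : b j = false := by rw [hb, set2_apply_right]
      have hbA : ∀ k ∈ A ∪ {i, j}, b k = false := by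
        intro k hk
        rcases mem_union.1 hk with hk | hk
        · rw [hb, set2_apply_ne u _ _ (ne_of_mem_of_not_mem hk hiA) (ne_of_mem_of_not_mem hk hjA)]
          exact huA k hk
        · simp only [mem_insert, mem_singleton] at hk
          rcases hk with rfl | rfl
          · exact hbi
          · exact hbj
      have hub : ∀ x y, set2 b i j x y = set2 u i j x y := fun x y => by
        rw [hb, set2_set2 u hij]
      have huself : set2 u i j (u i) (u j) = u := set2_eq_self u hij rfl rfl
      -- name the two bits and rewrite the goal in terms of the base point b
      obtain ⟨x, hx⟩ : ∃ x, u i = x := ⟨_, rfl⟩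
      obtain ⟨y, hy⟩ : ∃ y, u j = y := ⟨_, rfl⟩
      have hu_eq : u = set2 b i j x y := by rw [hub, set2_eq_self u hij hx hy]
      have hbmem : b ∈ parityCoset z (xor ε (xor x y)) := by
        rw [← mem_parityCoset_set2 ε b hij hbi hbj, ← hu_eq]; exact hu
      rw [hx, hy, ← hub (!x) (!y)]
      conv_rhs => rw [hu_eq]
      revert hbmem
      cases x <;> cases y <;> simp only [Bool.not_false, Bool.not_true, Bool.xor_false,
        Bool.xor_true] <;> intro hbmem
      · -- (0,0): flip = b^{11}, base = b
        rw [set2_eq_self b hij hbi hbj]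
        exact hP i j hij hiA hjA b hbmem hbA
      · -- (0,1): 01 → 10
        exact hQ i j hij hiA hjA b hbmem hbA
      · -- (1,0): 10 → 01
        exact (hQ i j hij hiA hjA b hbmem hbA).symm
      · -- (1,1): flip = b, base = b^{11}
        rw [set2_eq_self b hij hbi hbj]
        exact (hP i j hij hiA hjA b hbmem hbA).symm
    -- hence R is constant on H_ε ∩ {u|_A = 0}, and the constant is 0
    intro u hu huA
    refine zero_of_const hω A hmK a w ε (holoSum ω a w u) (fun g hg => ?_) (fun v hv hvA =>
      eq_of_toggle2_invariant (holoSum ω a w) A ε hinv hv hvA hu huA) u hu huA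
    have := hsupp g hg; omega

/-- **Degree silence (`P-38l`; typed `AffBells35.DegreeSilence` verbatim).**  A sparse holomorphic
sum `R = Σ_g a_g Q_{w_g}` of `m` characters, every live term of width `≥ 2d + K` with
`2m(K+1) < 2^K`, which agrees on the parity coset `H_ε` with a function `L ∈ lowDeg F z d`, vanishes
identically on `H_ε` (`d = 0` is `sparseKappa`).
[cite: BarringtonStraubingTherien1990, §6 (uncertainty principle); degree form supplied here (qa-qnc0 ROUND-34 §12.6(e))] -/
theorem degreeSilence (F : Type*) [Field F] [CharP F 2] (ω : F) (hω : ω ^ 2 + ω + 1 = 0)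
    (z m d K : ℕ) (a : Fin m → F) (w : Fin m → Fin z → ZMod 3) (ε : Bool) (L : CubeFn F z)
    (_hz : 0 < z) (hmK : 2 * m * (K + 1) < 2 ^ K)
    (hsupp : ∀ g, a g ≠ 0 → 2 * d + K ≤ (wsupp (w g)).card) (hL : L ∈ lowDeg F z d)
    (hRL : ∀ u ∈ parityCoset z ε, holoSum ω a w u = L u) :
    ∀ u ∈ parityCoset z ε, holoSum ω a w u = 0 := by
  classical
  intro u hu
  refine silence_frozen hω hmK w d ∅ ε a L (fun g hg => ?_) hL (fun v hv _ => hRL v hv) u hu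
    (fun i hi => absurd hi (by simp))
  have h := hsupp g hg
  unfold wsupp at h
  convert h using 2
  ext i; simp

end Main

/-! ### 7. Constancy criteria from character tests (P-38x grid tests, P-38v two-zero tests) -/

section Grid

variable {i j : Fin z}

/-- A coset point agreeing with `u` off `{i, j}` is `u` or its double flip. [folklore] -/
private theorem eq_or_eq_flip2 {ε : Bool} {u u'' : Fin z → Bool} (hij : i ≠ j)
    (hu : u ∈ parityCoset z ε) (hu'' : u'' ∈ parityCoset z ε)
    (hagree : ∀ k, k ≠ i → k ≠ j → u'' k = u k) :
    u'' = u ∨ u'' = set2 u i j (!u i) (!u j) := by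
  set u₀ := set2 u i j false false with hu₀
  have h0i : u₀ i = false := set2_apply_left u hij _ _
  have h0j : u₀ j = false := set2_apply_right u _ _
  have hu_eq : set2 u₀ i j (u i) (u j) = u := by
    rw [hu₀, set2_set2 u hij, set2_eq_self u hij rfl rfl]
  have hu''_eq : set2 u₀ i j (u'' i) (u'' j) = u'' := by
    rw [hu₀, set2_set2 u hij]
    funext k
    by_cases hkj : k = j
    · subst hkj; rw [set2_apply_right]
    by_cases hki : k = i
    · subst hki; rw [set2_apply_left _ hij]
    rw [set2_apply_ne _ _ _ hki hkj, hagree k hki hkj]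
  have h1 := (mem_parityCoset_set2 ε u₀ hij h0i h0j (u i) (u j)).1 (hu_eq.symm ▸ hu)
  have h2 := (mem_parityCoset_set2 ε u₀ hij h0i h0j (u'' i) (u'' j)).1 (hu''_eq.symm ▸ hu'')
  rw [mem_parityCoset'] at h1 h2
  have key : ∀ e a b c d : Bool, xor e (xor a b) = xor e (xor c d) →
      (c = a ∧ d = b) ∨ (c = !a ∧ d = !b) := by decide
  rcases key ε (u i) (u j) (u'' i) (u'' j) (h1.symm.trans h2) with ⟨hx, hy⟩ | ⟨hx, hy⟩
  · left; rw [← hu''_eq, hx, hy, hu_eq]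
  · right; rw [← hu''_eq, hx, hy, hu₀, set2_set2 u hij]

/-- The double flip of a coset point stays in the coset. [folklore] -/
private theorem flip2_mem_parityCoset {ε : Bool} {u : Fin z → Bool} (hij : i ≠ j)
    (hu : u ∈ parityCoset z ε) : set2 u i j (!u i) (!u j) ∈ parityCoset z ε := by
  set u₀ := set2 u i j false false with hu₀
  have h0i : u₀ i = false := set2_apply_left u hij _ _
  have h0j : u₀ j = false := set2_apply_right u _ _
  have hu_eq : set2 u₀ i j (u i) (u j) = u := by
    rw [hu₀, set2_set2 u hij, set2_eq_self u hij rfl rfl]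
  have hflip_eq : set2 u₀ i j (!u i) (!u j) = set2 u i j (!u i) (!u j) := by
    rw [hu₀, set2_set2 u hij]
  have h1 := (mem_parityCoset_set2 ε u₀ hij h0i h0j (u i) (u j)).1 (hu_eq.symm ▸ hu)
  rw [← hflip_eq, mem_parityCoset_set2 ε u₀ hij h0i h0j]
  have : xor (!u i) (!u j) = xor (u i) (u j) := by cases u i <;> cases u j <;> rfl
  rw [this]; exact h1

variable [CharP F 2]

/-- `ω^k ≠ 1` for `k ≠ 0` (char `2`). [folklore] -/
private theorem chi_ne_one {ω : F} (hω : ω ^ 2 + ω + 1 = 0) {k : ZMod 3} (hk : k ≠ 0) :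
    ω ^ k.val ≠ 1 := by
  have h2 : (2 : F) = 0 := by
    have := CharP.cast_eq_zero F 2
    simpa using this
  have hval : k.val = 1 ∨ k.val = 2 := by
    have := k.val_lt
    have h0 : k.val ≠ 0 := fun h0 => hk ((ZMod.val_eq_zero k).1 h0)
    omega
  rcases hval with h | h <;> rw [h]
  · rw [pow_one]
    intro h1
    rw [h1] at hω
    have : (1 : F) = 0 := by linear_combination hω - h2
    exact one_ne_zero this
  · intro h22
    have hω0 : ω = 0 := by linear_combination hω - h22 - h2
    rw [hω0] at h22
    norm_num at h22

/-- **Grid criterion (P-38x; ROUND-34 §12.10(a)(1)), typed `AffBells35.GridConstOfTests` verbatim.**  A function on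
the parity coset `H_ε` whose character tests `Σ_{u ∈ H_ε} f(u) Q_v(u)` vanish for every `v` on the GRID
`Π_j {0, α_j}` (`α` zero-free) having two zero coordinates is constant on `H_ε`.  Proof: for `i ≠ j` the
per-coordinate functions `x ↦ 1, x ↦ ω^{α_k x}` (`k ≠ i, j`) span `F^{{0,1}}` (`ω^{α_k} ≠ 1`), so the indicator of
«`u` agrees with `b` off `{i, j}`» is a combination of grid characters with zeros at `i, j`; hence
`f(u) + f(u^{ij}) = 0` for the two coset points over every base, i.e. `f` is invariant under double flips, and
double flips act transitively on `H_ε` (`eq_of_toggle2_invariant`).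
[cite: BarringtonStraubingTherien1990, §6 (characters of the cube); statement and proof supplied here
(qa-qnc0 ROUND-34 §12.10(a))] -/
theorem gridConstOfTests (F : Type*) [Field F] [CharP F 2] (ω : F) (hω : ω ^ 2 + ω + 1 = 0)
    (z : ℕ) (ε : Bool) (α : Fin z → ZMod 3) (f : (Fin z → Bool) → F) (hα : ∀ j, α j ≠ 0)
    (htest : ∀ v : Fin z → ZMod 3, (∀ j, v j = 0 ∨ v j = α j) → (∃ i j, i ≠ j ∧ v i = 0 ∧ v j = 0) →
      (∑ u ∈ parityCoset z ε, f u * cubeChar ω v u) = 0) :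
    ∀ u ∈ parityCoset z ε, ∀ u' ∈ parityCoset z ε, f u = f u' := by
  classical
  have h3 : ω ^ 3 = 1 := omega_pow_three' hω
  -- (P): for i ≠ j and every b, the sum of f over the coset points agreeing with b off {i, j} vanishes
  have hpair : ∀ i j : Fin z, i ≠ j → ∀ b : Fin z → Bool,
      ∑ u ∈ (parityCoset z ε).filter (fun u => ∀ k ∈ (univ.erase i).erase j, u k = b k), f u = 0 := by
    intro i j hij b
    set K : Finset (Fin z) := (univ.erase i).erase j with hK
    have hiK : i ∉ K := by simp [hK]
    have hjK : j ∉ K := by simp [hK]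
    -- per-coordinate characters and the dual basis
    let χ : Fin z → Bool → F := fun k x => if x then ω ^ (α k).val else 1
    let c : Fin z → F := fun k => ω ^ (α k).val - 1
    have hc : ∀ k, c k ≠ 0 := fun k => sub_ne_zero.2 (chi_ne_one hω (hα k))
    let A : Fin z → F := fun k => if b k then -1 / c k else ω ^ (α k).val / c k
    let B : Fin z → F := fun k => if b k then 1 / c k else -1 / c k
    -- each factor is the indicator of agreement with b
    have hind : ∀ k x, B k * χ k x + A k = if x = b k then 1 else 0 := by
      intro k x
      have hck := hc k
      cases x <;> cases hb : b k <;> simp [A, B, χ, hb] <;> field_simp <;> ring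
    -- D1: the product is the indicator of agreement on K
    have hD1 : ∀ u : Fin z → Bool,
        ∏ k ∈ K, (B k * χ k (u k) + A k) = if (∀ k ∈ K, u k = b k) then 1 else 0 := by
      intro u
      rw [prod_congr rfl fun k _ => hind k (u k)]
      by_cases h : ∀ k ∈ K, u k = b k
      · rw [if_pos h]
        exact prod_eq_one fun k hk => by rw [if_pos (h k hk)]
      · rw [if_neg h]
        push Not at h
        obtain ⟨k, hk, hne⟩ := h
        exact prod_eq_zero hk (by rw [if_neg hne])
    -- D2: the product expands over grid characters with zeros at i, j
    let vS : Finset (Fin z) → Fin z → ZMod 3 := fun S k => if k ∈ S then α k else 0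
    have hchar : ∀ (u : Fin z → Bool) (S : Finset (Fin z)),
        ∏ k ∈ S, χ k (u k) = cubeChar ω (vS S) u := by
      intro u S
      rw [cubeChar_eq_prod h3, ← prod_subset (subset_univ S) ?_]
      · exact prod_congr rfl fun k hk => by simp [χ, vS, hk]
      · intro k _ hk; simp [vS, hk]
    have hD2 : ∀ u : Fin z → Bool, ∏ k ∈ K, (B k * χ k (u k) + A k)
        = ∑ S ∈ K.powerset, ((∏ k ∈ S, B k) * ∏ k ∈ K \ S, A k) * cubeChar ω (vS S) u := by
      intro u
      rw [prod_add]
      refine sum_congr rfl fun S _ => ?_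
      rw [prod_mul_distrib, hchar]; ring
    -- every grid vector vS S, S ⊆ K, is a legal test
    have hgrid : ∀ S ∈ K.powerset, (∑ u ∈ parityCoset z ε, f u * cubeChar ω (vS S) u) = 0 := by
      intro S hS
      have hSK : S ⊆ K := mem_powerset.1 hS
      refine htest (vS S) (fun k => ?_) ⟨i, j, hij, ?_, ?_⟩
      · by_cases hk : k ∈ S
        · right; simp [vS, hk]
        · left; simp [vS, hk]
      · have : i ∉ S := fun h => hiK (hSK h)
        simp [vS, this]
      · have : j ∉ S := fun h => hjK (hSK h)
        simp [vS, this]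
    calc ∑ u ∈ (parityCoset z ε).filter (fun u => ∀ k ∈ K, u k = b k), f u
        = ∑ u ∈ parityCoset z ε, f u * ∏ k ∈ K, (B k * χ k (u k) + A k) := by
          rw [sum_filter]
          refine sum_congr rfl fun u _ => ?_
          rw [hD1, mul_ite, mul_one, mul_zero]
      _ = ∑ u ∈ parityCoset z ε, ∑ S ∈ K.powerset,
            ((∏ k ∈ S, B k) * ∏ k ∈ K \ S, A k) * (f u * cubeChar ω (vS S) u) := by
          refine sum_congr rfl fun u _ => ?_
          rw [hD2, mul_sum]
          exact sum_congr rfl fun S _ => by ring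
      _ = ∑ S ∈ K.powerset, ((∏ k ∈ S, B k) * ∏ k ∈ K \ S, A k) *
            ∑ u ∈ parityCoset z ε, f u * cubeChar ω (vS S) u := by
          rw [sum_comm]
          exact sum_congr rfl fun S _ => by rw [mul_sum]
      _ = 0 := sum_eq_zero fun S hS => by rw [hgrid S hS, mul_zero]
  -- double-flip invariance
  have hinv : ∀ u ∈ parityCoset z ε, (∀ k ∈ (∅ : Finset (Fin z)), u k = false) →
      ∀ i j : Fin z, i ≠ j → i ∉ (∅ : Finset (Fin z)) → j ∉ (∅ : Finset (Fin z)) →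
      f (Function.update (Function.update u i (!u i)) j (!u j)) = f u := by
    intro u hu _ i j hij _ _
    change f (set2 u i j (!u i) (!u j)) = f u
    set u' : Fin z → Bool := set2 u i j (!u i) (!u j) with hu'def
    have hne : u ≠ u' := by
      intro h
      have := congrFun h i
      rw [hu'def, set2_apply_left u hij] at this
      cases hui : u i <;> simp [hui] at this
    have hT : (parityCoset z ε).filter (fun u'' => ∀ k ∈ (univ.erase i).erase j, u'' k = u k)
        = {u, u'} := by
      ext u''
      simp only [mem_filter, mem_insert, mem_singleton, mem_erase, mem_univ, and_true]
      constructor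
      · rintro ⟨hu'', hagree⟩
        exact eq_or_eq_flip2 hij hu hu'' fun k hki hkj => hagree k ⟨hkj, hki⟩
      · rintro (rfl | rfl)
        · exact ⟨hu, fun k _ => rfl⟩
        · exact ⟨flip2_mem_parityCoset hij hu, fun k hk => set2_apply_ne u _ _ hk.2 hk.1⟩
    have hsum := hpair i j hij u
    rw [hT, sum_pair hne] at hsum
    linear_combination hsum - CharTwo.add_self_eq_zero (f u)
  intro u hu u' hu'
  exact eq_of_toggle2_invariant f ∅ ε hinv hu (by simp) hu' (by simp)

/-- **Two-zero criterion (P-38v; ROUND-34 §12.8), typed `AffBells35.CosetConstOfTests` verbatim.**  A function on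
the parity coset whose character tests vanish for every exponent vector with two prescribed zero coordinates is
constant on the coset — the `α ≡ 1` case of `gridConstOfTests`.
[cite: BarringtonStraubingTherien1990, §6; statement and proof supplied here (qa-qnc0 ROUND-34 §12.8)] -/
theorem cosetConstOfTests (F : Type*) [Field F] [CharP F 2] (ω : F) (hω : ω ^ 2 + ω + 1 = 0)
    (z : ℕ) (ε : Bool) (f : (Fin z → Bool) → F)
    (htest : ∀ v : Fin z → ZMod 3, (∃ i j, i ≠ j ∧ v i = 0 ∧ v j = 0) →
      (∑ u ∈ parityCoset z ε, f u * cubeChar ω v u) = 0) :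
    ∀ u ∈ parityCoset z ε, ∀ u' ∈ parityCoset z ε, f u = f u' :=
  gridConstOfTests F ω hω z ε (fun _ => 1) f (fun _ => by decide) fun v _ hv => htest v hv

end Grid

end CosetDegreeSilence

end Literature.Computability.MetaComplexity
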